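import Literature.Geometry.Riemannian.MetricFlowFDistance
import Literature.Geometry.Riemannian.WassersteinW1Triangle
import HarnessLib

/-!
# Symmetry of the `𝔽`-distance (Bamler 2023, §5.1, Lemma 5.12: "descends to a symmetric function")

R. Bamler, *Compactness theory of the space of super Ricci flows*, Invent. Math. 233 (2023), §5.1,
Lemma (arXiv v1 Lemma 111): "`d^J_𝔽` … descends to a symmetric function
`d^J_𝔽 : 𝔽^J_I × 𝔽^J_I → [0, ∞]`", "a direct consequence of Definitions (𝔽-distance within
correspondence), (𝔽-distance)". We prove the symmetry `d^J_𝔽(𝒳¹, 𝒳²) = d^J_𝔽(𝒳², 𝒳¹)`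
(`MetricFlowPair.fDist_comm`): a correspondence between `𝒳¹, 𝒳²` is turned into one between
`𝒳², 𝒳¹` with the same comparison spaces by exchanging the two families of embeddings
(`Correspondence₂.swap`), the couplings are pushed forward by `Prod.swap`, and the integrand is
symmetric (`wassersteinW1_comm`), so the admissible radii — hence `d^{ℭ,J}_𝔽` and the infimum over
all correspondences — agree (`FDistAdmissible.swap`, `fDistWithin_swap`).

## References

* R. H. Bamler, *Compactness theory of the space of super Ricci flows*, Invent. Math. 233 (2023),
  1121–1277, §5.1, Definitions (correspondence, 𝔽-distance within correspondence, 𝔽-distance) and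
  Lemma (symmetry/invariance). [Bamler2023]
-/

noncomputable section

open Set MeasureTheory Filter TopologicalSpace Function
open scoped Topology ENNReal NNReal

namespace Literature.Geometry.Riemannian

universe u

namespace MetricFlow

namespace Correspondence₂

variable {I₁ I₂ : Set ℝ} {𝒳₁ : MetricFlow.{u} I₁} {𝒳₂ : MetricFlow.{u} I₂} {I'' : Set ℝ}

/-- **The swapped correspondence**: a correspondence between `𝒳¹, 𝒳²` over `I''` read as one
between `𝒳², 𝒳¹` — same comparison spaces `(Z_t, d^Z_t)`, the two domains and the two families
of isometric embeddings exchanged. [cite: Bamler2023, §5.1, Definition (Correspondence)] -/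
@[reducible] def swap (ℭ : Correspondence₂ 𝒳₁ 𝒳₂ I'') : Correspondence₂ 𝒳₂ 𝒳₁ I'' where
  Z := ℭ.Z
  dom₁ := ℭ.dom₂
  dom₂ := ℭ.dom₁
  dom₁_subset := ℭ.dom₂_subset
  dom₂_subset := ℭ.dom₁_subset
  φ₁ := ℭ.φ₂
  φ₂ := ℭ.φ₁
  isometry₁ := ℭ.isometry₂
  isometry₂ := ℭ.isometry₁

/-- Swapping twice gives back the correspondence. [cite: Bamler2023, §5.1, Definition (Correspondence)] -/
@[simp] theorem swap_swap (ℭ : Correspondence₂ 𝒳₁ 𝒳₂ I'') : ℭ.swap.swap = ℭ := rfl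

/-- The swapped correspondence is fully defined over the same sets.
[cite: Bamler2023, §5.1, Definition (Correspondence)] -/
theorem FullyDefinedOver.swap {ℭ : Correspondence₂ 𝒳₁ 𝒳₂ I''} {J : Set ℝ}
    (h : ℭ.FullyDefinedOver J) : ℭ.swap.FullyDefinedOver J :=
  ⟨h.2, h.1⟩

end Correspondence₂

end MetricFlow

namespace MetricFlowPair

open MetricFlow

variable {I₁ I₂ : Set ℝ} {P₁ : MetricFlowPair.{u} I₁} {P₂ : MetricFlowPair.{u} I₂} {I'' : Set ℝ}

/-- The integrand of the `𝔽`-distance is symmetric under swapping the correspondence and the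
pair of points: `d_{W₁}((φ²_s)_* ν²_{x²;s}, (φ¹_s)_* ν¹_{x¹;s}) = d_{W₁}((φ¹_s)_* ν¹_{x¹;s}, (φ²_s)_* ν²_{x²;s})`.
[cite: Bamler2023, §5.1, Definition (F-distance within correspondence)] -/
theorem kernelDistWithin_swap (ℭ : Correspondence₂ P₁.flow P₂.flow I'') {s t : ℝ}
    (hs₁ : s ∈ ℭ.dom₁) (hs₂ : s ∈ ℭ.dom₂) (ht₁ : t ∈ ℭ.dom₁) (ht₂ : t ∈ ℭ.dom₂)
    (p : P₁.flow.Slice ⟨t, (ℭ.dom₁_subset ht₁).1⟩ × P₂.flow.Slice ⟨t, (ℭ.dom₂_subset ht₂).1⟩) :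
    kernelDistWithin P₂ P₁ ℭ.swap hs₂ hs₁ ht₂ ht₁ p.swap =
      kernelDistWithin P₁ P₂ ℭ hs₁ hs₂ ht₁ ht₂ p :=
  wassersteinW1_comm _ _

/-- **Admissible radii are symmetric**: if `r` is admissible for `d^{ℭ,J}_𝔽(𝒳¹, 𝒳²)`, it is
admissible for `d^{ℭ.swap,J}_𝔽(𝒳², 𝒳¹)` (same `E`, couplings pushed forward by `Prod.swap`,
symmetric integrand). [cite: Bamler2023, §5.1, Definition (F-distance within correspondence)] -/
theorem FDistAdmissible.swap {ℭ : Correspondence₂ P₁.flow P₂.flow I''} {J : Set ℝ} {r : ℝ}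
    (h : FDistAdmissible P₁ P₂ ℭ J r) : FDistAdmissible P₂ P₁ ℭ.swap J r := by
  obtain ⟨hr, E, hEm, hEI, hJ, hE₁, hE₂, hvol, q, hq, hint⟩ := h
  refine ⟨hr, E, hEm, hEI, hJ, hE₂, hE₁, hvol, fun t ht ↦ (q t ht).map Prod.swap, fun t ht ↦ ?_,
    fun s hs t ht hst ↦ ?_⟩
  · obtain ⟨hP, h1, h2⟩ := hq t ht
    haveI := hP
    exact ⟨Measure.isProbabilityMeasure_map measurable_swap.aemeasurable,
      by rw [Measure.fst_map_swap]; exact h2, by rw [Measure.snd_map_swap]; exact h1⟩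
  · refine le_trans (le_of_eq ?_) (hint s hs t ht hst)
    change ∫⁻ p, kernelDistWithin P₂ P₁ ℭ.swap (hE₂ hs) (hE₁ hs) (hE₂ ht) (hE₁ ht) p
      ∂((q t ht).map Prod.swap) = _
    rw [show (Prod.swap : P₁.flow.Slice ⟨t, (ℭ.dom₁_subset (hE₁ ht)).1⟩ ×
          P₂.flow.Slice ⟨t, (ℭ.dom₂_subset (hE₂ ht)).1⟩ → _) =
        ⇑(MeasurableEquiv.prodComm : _ ≃ᵐ _) from rfl, lintegral_map_equiv]
    refine lintegral_congr fun p ↦ ?_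
    simp only [MeasurableEquiv.prodComm, MeasurableEquiv.coe_mk, Equiv.prodComm_apply]
    exact kernelDistWithin_swap ℭ (hE₁ hs) (hE₂ hs) (hE₁ ht) (hE₂ ht) p

/-- **`d^{ℭ.swap,J}_𝔽(𝒳², 𝒳¹) = d^{ℭ,J}_𝔽(𝒳¹, 𝒳²)`.**
[cite: Bamler2023, §5.1, Definition (F-distance within correspondence)] -/
theorem fDistWithin_swap (ℭ : Correspondence₂ P₁.flow P₂.flow I'') (J : Set ℝ) :
    fDistWithin P₂ P₁ ℭ.swap J = fDistWithin P₁ P₂ ℭ J := by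
  refine le_antisymm ?_ ?_
  · exact le_fDistWithin_iff.2 fun r hr ↦ fDistWithin_le hr.swap
  · refine le_fDistWithin_iff.2 fun r hr ↦ fDistWithin_le ?_
    have := hr.swap
    rwa [Correspondence₂.swap_swap] at this

/-- **Symmetry of the `𝔽`-distance**: `d^J_𝔽(𝒳¹, 𝒳²) = d^J_𝔽(𝒳², 𝒳¹)` for metric flow pairs
over a common `I` (Bamler 2023, §5.1, Lemma: `d^J_𝔽` is a symmetric function; swap the
correspondences). [cite: Bamler2023, §5.1, Lemma (symmetry of the F-distance)] -/
theorem fDist_comm {I : Set ℝ} (J : Set ℝ) (P₁ P₂ : MetricFlowPair.{u} I) :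
    fDist J P₁ P₂ = fDist J P₂ P₁ := by
  suffices h : ∀ Q₁ Q₂ : MetricFlowPair.{u} I, fDist J Q₂ Q₁ ≤ fDist J Q₁ Q₂ from
    le_antisymm (h P₂ P₁) (h P₁ P₂)
  intro Q₁ Q₂
  refine le_iInf₂ fun ℭ hℭ ↦ ?_
  exact (fDist_le_fDistWithin ℭ.swap hℭ.swap).trans_eq (fDistWithin_swap ℭ J)

end MetricFlowPair

end Literature.Geometry.Riemannian

end
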